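import Mathlib.Data.ZMod.Basic
import Literature.Topology.FourManifolds.KhFlipDegree
import HarnessLib

/-!
# The `X`-action and the `q mod 4` splitting of Lee's complex

Chain-level structure of Lee's complex (`(h, t) = (0, 1)`, `X² = 1`) of an arbitrary Gauss
diagram `G`, continuing `KhFlipReach` and `KhFlipDegree`:

* `EnhancedState.actX s α`: multiplication by `X` on the circle through the arc `α` — in the
  basis `{1, X}` with `X² = 1` this swaps the label of that circle; it keeps the homological
  degree and changes the quantum degree by `∓ 2` (`qDegree_actX`);
* `incidence_actX`: the incidence numbers are invariant under `actX` applied to both states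
  (the Frobenius algebra `A = R[X]/(X² - 1)` is commutative and `m`, `Δ` are `A`-bilinear, so
  multiplication by `X` at a base point commutes with the differential: for a knot diagram the
  complex is a complex of `R[X]`-modules, Khovanov (2006), paragraph *Bar-Natan's theory and
  the Rasmussen invariant*, before Prop. 8, here at `t = 1`);
* the linear **`X`-operator** `leeX R α i` on the cochain group `degStates i → R`, an involution
  commuting with the differential (`khovanovD_comp_leeX`);
* the **`q mod 4` projectors** `qProj R ρ i` (`ρ : ZMod 4`): complete orthogonal idempotents on
  each cochain group commuting with Lee's differential (`khovanovD_comp_qProj`, from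
  `qDegree_modEq_of_incidence_ne_zero`) and rotated by two by the `X`-operator
  (`leeX_comp_qProj`): Rasmussen's splitting `CKh' = CKh'_o ⊕ CKh'_e` with the involution
  exchanging behaviours (Rasmussen (2010), Lemma 3.5).

## Sources

* E. S. Lee, *An endomorphism of the Khovanov invariant*, Adv. Math. 197 (2005), §4.
* J. Rasmussen, *Khovanov homology and the slice genus*, Invent. Math. 182 (2010), §2,
  Lemma 3.5.
* M. Khovanov, *Link homology and Frobenius extensions*, Fund. Math. 190 (2006) 179–190,
  paragraph *Bar-Natan's theory and the Rasmussen invariant* (before Prop. 8: for a knot the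
  complex `C_t(D)` is a complex of free `ℚ[X]`-modules, `X² = t`; Lee's theory is `t = 1`).
* Mathlib: `LinearMap.funLeft`, `Matrix.toLin'_apply`, `Equiv.sum_comp`, `ZMod 4`.

## Design choices

* Total on `GaussDiagram`, no named fact: the one-to-one bifurcation case has incidence `0` on
  both sides of `incidence_actX`.
* Everything is over an arbitrary commutative ring `R` at `(h, t) = (0, 1)`; the operators act
  on the cast-free cochain groups `degStates i → R` of `KhComplex` for every `i : ℤ`.
-/

open Function Set

noncomputable section

namespace Literature.Topology.FourManifolds

namespace GaussDiagram

variable {G : GaussDiagram}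

/-! ## Multiplication by `X` on one circle -/

/-- **Multiplication by `X` on the circle through the arc `α`** of an enhanced state, for the
Frobenius algebra `R[X]/(X² - 1)` of Lee's theory: in the basis `1 ↔ false`, `X ↔ true` with
`X · 1 = X`, `X · X = 1`, this swaps the label of every arc on the state circle of `α` and keeps
the state. Khovanov (2006), *Bar-Natan's theory and the Rasmussen invariant* (the complex of a
knot diagram is a complex of `R[X]`-modules, `X² = t`; here `t = 1`). [cite: Khovanov2006, before Prop. 8] -/
def EnhancedState.actX (s : G.EnhancedState) (α : G.Arc) : G.EnhancedState where
  state := s.state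
  label v := if (G.stateGraph s.state).Reachable α v then !s.label v else s.label v
  label_eq u v huv := by
    by_cases hu : (G.stateGraph s.state).Reachable α u
    · have hv : (G.stateGraph s.state).Reachable α v := hu.trans huv.reachable
      rw [if_pos hu, if_pos hv, s.label_eq u v huv]
    · have hv : ¬ (G.stateGraph s.state).Reachable α v := fun h ↦ hu (h.trans huv.reachable.symm)
      rw [if_neg hu, if_neg hv, s.label_eq u v huv]

/-- `actX` keeps the state. [folklore] -/
@[simp]
theorem EnhancedState.actX_state (s : G.EnhancedState) (α : G.Arc) : (s.actX α).state = s.state :=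
  rfl

/-- The labels of `actX s α`: swapped on the circle of `α`, unchanged elsewhere. [folklore] -/
theorem EnhancedState.actX_label (s : G.EnhancedState) (α v : G.Arc) :
    (s.actX α).label v =
      if (G.stateGraph s.state).Reachable α v then !s.label v else s.label v :=
  rfl

/-- `actX` is an involution (`X² = 1`). Lee (2005), §4. [cite: Lee2005, §4] -/
@[simp]
theorem EnhancedState.actX_actX (s : G.EnhancedState) (α : G.Arc) : (s.actX α).actX α = s := by
  cases s with
  | mk σ ℓ hℓ =>
    simp only [EnhancedState.actX, EnhancedState.mk.injEq, true_and]
    funext v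
    by_cases h : (G.stateGraph σ).Reachable α v
    · rw [if_pos h, if_pos h, Bool.not_not]
    · rw [if_neg h, if_neg h]

/-- `actX` keeps the homological degree. [folklore] -/
@[simp]
theorem homDegree_actX (s : G.EnhancedState) (α : G.Arc) : homDegree (s.actX α) = homDegree s :=
  rfl

/-- The circle labels of `actX s α`: the label of the circle of `α` is swapped. [folklore] -/
theorem circleLabel_actX (s : G.EnhancedState) (α : G.Arc) (C : G.StateCircle s.state) :
    circleLabel (s.actX α) C =
      if C = G.circleOf s.state α then !circleLabel s C else circleLabel s C := by
  induction C using SimpleGraph.ConnectedComponent.ind with | h v => ?_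
  change (s.actX α).label v = if G.circleOf s.state v = G.circleOf s.state α then !s.label v
    else s.label v
  rw [EnhancedState.actX_label]
  by_cases h : (G.stateGraph s.state).Reachable α v
  · rw [if_pos h, if_pos (show G.circleOf s.state v = G.circleOf s.state α from
      SimpleGraph.ConnectedComponent.sound h.symm)]
  · rw [if_neg h, if_neg (show ¬ G.circleOf s.state v = G.circleOf s.state α from
      fun h' ↦ h (SimpleGraph.ConnectedComponent.exact h').symm)]

/-- **`actX` changes the quantum degree by `∓ 2`**: `qDegree (actX s α) = qDegree s - 2 · deg`,
where `deg = ± 1` is the degree of the old label of the circle of `α` (`1 ↦ X` lowers `q` by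
`2`, `X ↦ 1` raises it by `2`). In particular multiplication by `X` is filtered of degree `-2`
and shifts `q` by `2` modulo `4`. Rasmussen (2010), §2.1, Lemma 3.5. [cite: Rasmussen2010, Lemma 3.5] -/
theorem qDegree_actX (s : G.EnhancedState) (α : G.Arc) :
    qDegree (s.actX α) = qDegree s - 2 * labelDeg (s.label α) := by
  rw [qDegree_eq_sum_circleLabel, qDegree_eq_sum_circleLabel]
  change ∑ C : G.StateCircle s.state, labelDeg (circleLabel (s.actX α) C) + (s.state.weight : ℤ) +
    G.nPlus - 2 * G.nMinus = _
  have hmem : G.circleOf s.state α ∈ (Finset.univ : Finset (G.StateCircle s.state)) :=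
    Finset.mem_univ _
  rw [← Finset.add_sum_erase _ _ hmem, ← Finset.add_sum_erase _ (fun C ↦ labelDeg (circleLabel s C)) hmem]
  have hrest : ∑ C ∈ Finset.univ.erase (G.circleOf s.state α), labelDeg (circleLabel (s.actX α) C) =
      ∑ C ∈ Finset.univ.erase (G.circleOf s.state α), labelDeg (circleLabel s C) := by
    refine Finset.sum_congr rfl (fun C hC ↦ ?_)
    rw [Finset.mem_erase] at hC
    rw [circleLabel_actX, if_neg hC.1]
  rw [hrest, circleLabel_actX, if_pos rfl, labelDeg_not, circleLabel_circleOf]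
  ring

/-- `actX` never lowers the quantum degree by more than `2`. [folklore] -/
theorem qDegree_sub_two_le_qDegree_actX (s : G.EnhancedState) (α : G.Arc) :
    qDegree s - 2 ≤ qDegree (s.actX α) := by
  rw [qDegree_actX]
  cases s.label α <;> simp only [labelDeg_false, labelDeg_true] <;> omega

/-- `actX` shifts the quantum degree by `2` modulo `4`. Rasmussen (2010), Lemma 3.5. [cite: Rasmussen2010, Lemma 3.5] -/
theorem qDegree_actX_modEq (s : G.EnhancedState) (α : G.Arc) :
    qDegree (s.actX α) ≡ qDegree s + 2 [ZMOD 4] := by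
  rw [qDegree_actX, Int.ModEq]
  cases s.label α <;> simp only [labelDeg_false, labelDeg_true] <;> omega

/-! ## Invariance of the incidence numbers -/

section Ring

variable (R : Type) [CommRing R]

/-- `A`-linearity of the multiplication of `R[X]/(X² - 1)` in the first factor, on tables:
`m (X u ⊗ v) = X m (u ⊗ v)`. Lee (2005), §4. [cite: Lee2005, §4] -/
theorem mergeCoeff_lee_not_left (x y z : Bool) :
    mergeCoeff R 0 1 (!x) y (!z) = mergeCoeff R 0 1 x y z := by
  cases x <;> cases y <;> cases z <;> rfl

/-- `A`-linearity of the multiplication of `R[X]/(X² - 1)` in the second factor, on tables: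
`m (u ⊗ X v) = X m (u ⊗ v)`. Lee (2005), §4. [cite: Lee2005, §4] -/
theorem mergeCoeff_lee_not_right (x y z : Bool) :
    mergeCoeff R 0 1 x (!y) (!z) = mergeCoeff R 0 1 x y z := by
  cases x <;> cases y <;> cases z <;> rfl

/-- `A`-linearity of the comultiplication of `R[X]/(X² - 1)` through the first factor:
`Δ (X u) = (X ⊗ 1) Δ u`. Lee (2005), §4. [cite: Lee2005, §4] -/
theorem splitCoeff_lee_not_left (x y z : Bool) :
    splitCoeff R 0 1 (!x) (!y) z = splitCoeff R 0 1 x y z := by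
  cases x <;> cases y <;> cases z <;> simp [splitCoeff]

/-- `A`-linearity of the comultiplication of `R[X]/(X² - 1)` through the second factor:
`Δ (X u) = (1 ⊗ X) Δ u`. Lee (2005), §4. [cite: Lee2005, §4] -/
theorem splitCoeff_lee_not_right (x y z : Bool) :
    splitCoeff R 0 1 (!x) y (!z) = splitCoeff R 0 1 x y z := by
  cases x <;> cases y <;> cases z <;> simp [splitCoeff]

variable {R}

/-- Swapping two Booleans under the same condition preserves (in)equality. [folklore] -/
private theorem ite_not_eq_ite_not_iff (P : Prop) [Decidable P] (x y : Bool) :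
    ((if P then !x else x) = (if P then !y else y)) ↔ x = y := by
  by_cases hP : P
  · rw [if_pos hP, if_pos hP, Bool.not_inj_iff]
  · rw [if_neg hP, if_neg hP]

/-- Off the merged circle, old and new circles of an arc coincide (merge case). [folklore] -/
theorem IsMergeAt.reachable_update_iff_of_not {σ : G.State} {i : Fin G.n} (hm : G.IsMergeAt σ i)
    {α c : G.Arc}
    (hc : ¬ (G.stateGraph (Function.update σ i true)).Reachable c (G.arcIn (G.overPos i))) :
    (G.stateGraph (Function.update σ i true)).Reachable α c ↔ (G.stateGraph σ).Reachable α c := by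
  refine ⟨fun h ↦ ?_, hm.reachable_update_of_reachable⟩
  rcases (hm.reachable_update_iff α c).1 h with h | ⟨-, h⟩ | ⟨-, h⟩
  · exact h
  · exact (hc ((hm.reachable_update_of_reachable h).symm.trans hm.reachable_update.symm)).elim
  · exact (hc (hm.reachable_update_of_reachable h).symm).elim

/-- Off the split circle, old and new circles of an arc coincide (split case). [folklore] -/
theorem IsSplitAt.reachable_update_iff_of_not {σ : G.State} {i : Fin G.n} (hsp : G.IsSplitAt σ i)
    {α c : G.Arc} (hc : ¬ (G.stateGraph σ).Reachable c (G.arcIn (G.overPos i))) :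
    (G.stateGraph (Function.update σ i true)).Reachable α c ↔ (G.stateGraph σ).Reachable α c := by
  refine ⟨hsp.reachable_of_reachable_update, fun h ↦ ?_⟩
  rcases (hsp.reachable_iff α c).1 h with h' | ⟨h', -⟩ | ⟨h', -⟩
  · exact h'
  · exact (hc (h.symm.trans (hsp.reachable_of_reachable_update h'))).elim
  · exact (hc ((h.symm.trans (hsp.reachable_of_reachable_update h')).trans
      hsp.reachable.symm)).elim

/-- **The incidence numbers of Lee's complex are invariant under multiplication by `X` at an
arc** (applied to both enhanced states): `⟨d (X_α s), X_α s'⟩ = ⟨d s, s'⟩`. This is the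
statement that multiplication by `X` on the circle through a base point is a chain map, i.e.
that `m` and `Δ` are `A`-bilinear for the commutative Frobenius algebra `A = R[X]/(X² - 1)`
(Khovanov (2006), *Bar-Natan's theory and the Rasmussen invariant*: the complex of a knot
diagram is a complex of `R[X]`-modules); the bookkeeping of circles under merges and splits is
`KhFlipReach`. Total: for virtual diagrams the one-to-one bifurcations contribute `0` on both
sides. [cite: Khovanov2006, before Prop. 8] -/
theorem incidence_actX (s s' : G.EnhancedState) (α : G.Arc) :
    G.incidence R 0 1 (s.actX α) (s'.actX α) = G.incidence R 0 1 s s' := by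
  by_cases hex : ∃ i, s.state i = false ∧ s'.state = Function.update s.state i true
  swap
  · rw [incidence_of_not_flip R 0 1 hex, incidence_of_not_flip R 0 1 (by exact hex)]
  obtain ⟨i, hi, hs'⟩ := hex
  rw [incidence_of_flip R 0 1 hi hs', incidence_of_flip R 0 1 (s := s.actX α) (s' := s'.actX α)
    (i := i) hi hs']
  simp only [EnhancedState.actX]
  set a := G.arcIn (G.overPos i) with ha
  set b := G.arcOut (G.overPos i) with hb
  by_cases hm : G.IsMergeAt s.state i
  · -- merge
    rw [if_pos hm, if_pos hm]
    have key : ∀ c, ¬ (G.stateGraph s'.state).Reachable c a →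
        ((G.stateGraph s'.state).Reachable α c ↔ (G.stateGraph s.state).Reachable α c) :=
      fun c hc ↦ by
        rw [hs'] at hc ⊢
        exact hm.reachable_update_iff_of_not hc
    have hcond : (∀ c, G.circleOf s'.state c ≠ G.circleOf s'.state a →
        (if (G.stateGraph s'.state).Reachable α c then !s'.label c else s'.label c) =
          (if (G.stateGraph s.state).Reachable α c then !s.label c else s.label c)) ↔
        (∀ c, G.circleOf s'.state c ≠ G.circleOf s'.state a → s'.label c = s.label c) := by
      refine forall_congr' (fun c ↦ imp_congr_right (fun hc ↦ ?_))
      rw [circleOf, circleOf, Ne, SimpleGraph.ConnectedComponent.eq] at hc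
      simp only [key c hc]
      exact ite_not_eq_ite_not_iff _ _ _
    by_cases hlab : ∀ c, G.circleOf s'.state c ≠ G.circleOf s'.state a → s'.label c = s.label c
    swap
    · rw [if_neg hlab, if_neg (fun h ↦ hlab (hcond.1 h))]
    rw [if_pos hlab, if_pos (hcond.2 hlab)]
    congr 1
    by_cases hαa : (G.stateGraph s'.state).Reachable α a
    · -- `α` on the merged circle: it lies on exactly one of the two old circles
      have hor : (G.stateGraph s.state).Reachable α a ∨ (G.stateGraph s.state).Reachable α b := by
        have h := hαa
        rw [hs', hm.reachable_update_iff] at h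
        rcases h with h | ⟨h, -⟩ | ⟨h, -⟩
        · exact Or.inl h
        · exact Or.inl h
        · exact Or.inr h
      have hnot : ¬ ((G.stateGraph s.state).Reachable α a ∧ (G.stateGraph s.state).Reachable α b) :=
        fun h ↦ hm.not_reachable (h.1.symm.trans h.2)
      rw [if_pos hαa]
      rcases hor with h | h
      · have hb' : ¬ (G.stateGraph s.state).Reachable α b := fun h' ↦ hnot ⟨h, h'⟩
        rw [if_pos h, if_neg hb', mergeCoeff_lee_not_left]
      · have ha' : ¬ (G.stateGraph s.state).Reachable α a := fun h' ↦ hnot ⟨h', h⟩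
        rw [if_neg ha', if_pos h, mergeCoeff_lee_not_right]
    · have ha' : ¬ (G.stateGraph s.state).Reachable α a := fun h ↦ hαa (by
        rw [hs']
        exact hm.reachable_update_of_reachable h)
      have hb' : ¬ (G.stateGraph s.state).Reachable α b := fun h ↦ hαa (by
        rw [hs']
        exact (hm.reachable_update_of_reachable h).trans hm.reachable_update.symm)
      rw [if_neg hαa, if_neg ha', if_neg hb']
  · rw [if_neg hm, if_neg hm]
    by_cases hsp : G.IsSplitAt s.state i
    swap
    · rw [if_neg hsp, if_neg hsp]
    rw [if_pos hsp, if_pos hsp]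
    have hsub : ∀ {u v}, (G.stateGraph s'.state).Reachable u v → (G.stateGraph s.state).Reachable u v :=
      fun h ↦ by
        rw [hs'] at h
        exact hsp.reachable_of_reachable_update h
    have key : ∀ c, ¬ (G.stateGraph s.state).Reachable c a →
        ((G.stateGraph s'.state).Reachable α c ↔ (G.stateGraph s.state).Reachable α c) :=
      fun c hc ↦ by
        rw [hs']
        exact hsp.reachable_update_iff_of_not hc
    have hcond : (∀ c, G.circleOf s.state c ≠ G.circleOf s.state a →
        (if (G.stateGraph s'.state).Reachable α c then !s'.label c else s'.label c) =
          (if (G.stateGraph s.state).Reachable α c then !s.label c else s.label c)) ↔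
        (∀ c, G.circleOf s.state c ≠ G.circleOf s.state a → s'.label c = s.label c) := by
      refine forall_congr' (fun c ↦ imp_congr_right (fun hc ↦ ?_))
      rw [circleOf, circleOf, Ne, SimpleGraph.ConnectedComponent.eq] at hc
      simp only [key c hc]
      exact ite_not_eq_ite_not_iff _ _ _
    by_cases hlab : ∀ c, G.circleOf s.state c ≠ G.circleOf s.state a → s'.label c = s.label c
    swap
    · rw [if_neg hlab, if_neg (fun h ↦ hlab (hcond.1 h))]
    rw [if_pos hlab, if_pos (hcond.2 hlab)]
    congr 1
    by_cases hαa : (G.stateGraph s.state).Reachable α a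
    · -- `α` on the split circle: it lies on exactly one of the two new circles
      have hor : (G.stateGraph s'.state).Reachable α a ∨ (G.stateGraph s'.state).Reachable α b := by
        have h := hαa
        rw [hsp.reachable_iff, ← hs'] at h
        rcases h with h | ⟨h, -⟩ | ⟨h, -⟩
        · exact Or.inl h
        · exact Or.inl h
        · exact Or.inr h
      have hnot : ¬ ((G.stateGraph s'.state).Reachable α a ∧
          (G.stateGraph s'.state).Reachable α b) := fun h ↦ by
        have h' := h.1.symm.trans h.2
        rw [hs'] at h'
        exact hsp.not_reachable_update h'
      rw [if_pos hαa]
      rcases hor with h | h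
      · have hb' : ¬ (G.stateGraph s'.state).Reachable α b := fun h' ↦ hnot ⟨h, h'⟩
        rw [if_pos h, if_neg hb', splitCoeff_lee_not_left]
      · have ha' : ¬ (G.stateGraph s'.state).Reachable α a := fun h' ↦ hnot ⟨h', h⟩
        rw [if_neg ha', if_pos h, splitCoeff_lee_not_right]
    · have ha' : ¬ (G.stateGraph s'.state).Reachable α a := fun h ↦ hαa (hsub h)
      have hb' : ¬ (G.stateGraph s'.state).Reachable α b := fun h ↦
        hαa ((hsub h).trans hsp.reachable.symm)
      rw [if_neg hαa, if_neg ha', if_neg hb']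

/-! ## The `X`-operator on cochains -/

variable (G R)

/-- `actX` on the enhanced states of a fixed homological degree. [folklore] -/
def actXDeg (α : G.Arc) (i : ℤ) (s : G.degStates i) : G.degStates i :=
  ⟨s.1.actX α, (homDegree_actX s.1 α).trans s.2⟩

/-- `actXDeg` is an involution. [folklore] -/
@[simp]
theorem actXDeg_actXDeg (α : G.Arc) (i : ℤ) (s : G.degStates i) :
    G.actXDeg α i (G.actXDeg α i s) = s :=
  Subtype.ext (EnhancedState.actX_actX s.1 α)

/-- `actXDeg` is an involution. [folklore] -/
theorem involutive_actXDeg (α : G.Arc) (i : ℤ) : Involutive (G.actXDeg α i) :=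
  G.actXDeg_actXDeg α i

/-- The **`X`-operator** on the `i`-th cochain group `degStates i → R` of Lee's complex:
multiplication by `X` on the circle through the arc `α`, i.e. precomposition of coefficient
functions with the involution `actXDeg α i` of the basis of enhanced states.
Khovanov (2006), *Bar-Natan's theory and the Rasmussen invariant* (`C_t(D)` is a complex of
`R[X]`-modules for a knot diagram `D`; `t = 1`). [cite: Khovanov2006, before Prop. 8] -/
def leeX (α : G.Arc) (i : ℤ) : (G.degStates i → R) →ₗ[R] (G.degStates i → R) :=
  LinearMap.funLeft R R (G.actXDeg α i)

/-- The `X`-operator on a coefficient function. [folklore] -/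
@[simp]
theorem leeX_apply (α : G.Arc) (i : ℤ) (f : G.degStates i → R) (s : G.degStates i) :
    G.leeX R α i f s = f (G.actXDeg α i s) :=
  rfl

/-- The `X`-operator is an involution (`X² = 1`). Lee (2005), §4. [cite: Lee2005, §4] -/
theorem leeX_comp_leeX (α : G.Arc) (i : ℤ) : G.leeX R α i ∘ₗ G.leeX R α i = LinearMap.id := by
  ext f s
  simp

/-- The `X`-operator applied twice is the identity. [folklore] -/
@[simp]
theorem leeX_leeX (α : G.Arc) (i : ℤ) (f : G.degStates i → R) :
    G.leeX R α i (G.leeX R α i f) = f := by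
  funext s
  simp

/-- The differential on a coefficient function: `(d f) s' = Σ_s ⟨d s, s'⟩ · f s`. [folklore] -/
theorem khovanovD_apply (h t : R) (i i' : ℤ) (f : G.degStates i → R) (s' : G.degStates i') :
    G.khovanovD R h t i i' f s' = ∑ s, G.incidence R h t s.1 s'.1 * f s := by
  simp [khovanovD, Matrix.toLin'_apply, Matrix.mulVec, dotProduct]

/-- **The `X`-operator is a chain map**: it commutes with Lee's differential between any two
homological degrees (`incidence_actX`). Khovanov (2006), *Bar-Natan's theory and the Rasmussen
invariant* (the complex of a knot diagram is a complex of `R[X]`-modules). [cite: Khovanov2006, before Prop. 8] -/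
theorem khovanovD_comp_leeX (α : G.Arc) (i i' : ℤ) :
    G.khovanovD R 0 1 i i' ∘ₗ G.leeX R α i = G.leeX R α i' ∘ₗ G.khovanovD R 0 1 i i' := by
  refine LinearMap.ext (fun f ↦ funext (fun s' ↦ ?_))
  simp only [LinearMap.coe_comp, Function.comp_apply, leeX_apply, khovanovD_apply]
  have hsum := (involutive_actXDeg G α i).bijective.sum_comp
    (fun s ↦ G.incidence R 0 1 (G.actXDeg α i s).1 s'.1 * f s)
  simp only [actXDeg_actXDeg] at hsum
  rw [hsum]
  refine Finset.sum_congr rfl (fun s _ ↦ ?_)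
  congr 1
  have key := incidence_actX (R := R) s.1 (G.actXDeg α i' s').1 α
  simpa [actXDeg] using key

/-! ## The `q mod 4` projectors -/

/-- The **`q mod 4` projector** on the `i`-th cochain group: keep the coefficients of the
enhanced states of quantum degree `≡ ρ (mod 4)` and kill the others. Lee's complex is the
direct sum over `ρ` of the images (`khovanovD_comp_qProj`). Rasmussen (2010), Lemma 3.5
(`CKh' = CKh'_o ⊕ CKh'_e`). [cite: Rasmussen2010, Lemma 3.5] -/
def qProj (ρ : ZMod 4) (i : ℤ) : (G.degStates i → R) →ₗ[R] (G.degStates i → R) where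
  toFun f s := if ((qDegree s.1 : ℤ) : ZMod 4) = ρ then f s else 0
  map_add' f g := by
    funext s
    simp only [Pi.add_apply]
    split_ifs <;> simp
  map_smul' c f := by
    funext s
    simp only [Pi.smul_apply, smul_eq_mul, RingHom.id_apply]
    split_ifs <;> simp

/-- The `q mod 4` projector on a coefficient function. [folklore] -/
@[simp]
theorem qProj_apply (ρ : ZMod 4) (i : ℤ) (f : G.degStates i → R) (s : G.degStates i) :
    G.qProj R ρ i f s = if ((qDegree s.1 : ℤ) : ZMod 4) = ρ then f s else 0 :=
  rfl

/-- The `q mod 4` projectors are idempotent. [folklore] -/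
theorem qProj_comp_qProj_self (ρ : ZMod 4) (i : ℤ) :
    G.qProj R ρ i ∘ₗ G.qProj R ρ i = G.qProj R ρ i := by
  ext f s
  simp only [LinearMap.coe_comp, Function.comp_apply, qProj_apply]
  split_ifs <;> rfl

/-- The `q mod 4` projectors are mutually orthogonal. [folklore] -/
theorem qProj_comp_qProj_of_ne {ρ ρ' : ZMod 4} (hρ : ρ ≠ ρ') (i : ℤ) :
    G.qProj R ρ i ∘ₗ G.qProj R ρ' i = 0 := by
  ext f s
  simp only [LinearMap.coe_comp, Function.comp_apply, qProj_apply, LinearMap.zero_apply,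
    Pi.zero_apply]
  split_ifs with h h'
  · exact (hρ (h.symm.trans h')).elim
  · rfl
  · rfl

/-- The `q mod 4` projectors sum to the identity. [folklore] -/
theorem sum_qProj (i : ℤ) : ∑ ρ : ZMod 4, G.qProj R ρ i = LinearMap.id := by
  refine LinearMap.ext (fun f ↦ funext (fun s ↦ ?_))
  simp only [LinearMap.coe_sum, Finset.sum_apply, qProj_apply, LinearMap.id_coe, id_eq]
  rw [Finset.sum_ite_eq Finset.univ ((qDegree s.1 : ℤ) : ZMod 4) (fun _ ↦ f s)]
  simp

/-- **Lee's differential commutes with the `q mod 4` projectors** (it preserves the quantum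
degree modulo `4`, `qDegree_modEq_of_incidence_ne_zero`): Lee's complex is the direct sum of
the four subcomplexes `q ≡ ρ (mod 4)`. Rasmussen (2010), Lemma 3.5. [cite: Rasmussen2010, Lemma 3.5] -/
theorem khovanovD_comp_qProj (ρ : ZMod 4) (i i' : ℤ) :
    G.khovanovD R 0 1 i i' ∘ₗ G.qProj R ρ i = G.qProj R ρ i' ∘ₗ G.khovanovD R 0 1 i i' := by
  refine LinearMap.ext (fun f ↦ funext (fun s' ↦ ?_))
  simp only [LinearMap.coe_comp, Function.comp_apply, khovanovD_apply, qProj_apply]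
  by_cases hs' : ((qDegree s'.1 : ℤ) : ZMod 4) = ρ
  · rw [if_pos hs']
    refine Finset.sum_congr rfl (fun s _ ↦ ?_)
    by_cases h0 : G.incidence R 0 1 s.1 s'.1 = 0
    · rw [h0, zero_mul, zero_mul]
    · have hq := (ZMod.intCast_eq_intCast_iff _ _ 4).2 (qDegree_modEq_of_incidence_ne_zero R h0)
      rw [if_pos (hq.symm.trans hs')]
  · rw [if_neg hs']
    refine Finset.sum_eq_zero (fun s _ ↦ ?_)
    by_cases h0 : G.incidence R 0 1 s.1 s'.1 = 0
    · rw [h0, zero_mul]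
    · have hq := (ZMod.intCast_eq_intCast_iff _ _ 4).2 (qDegree_modEq_of_incidence_ne_zero R h0)
      rw [if_neg (fun h ↦ hs' (hq.trans h)), mul_zero]

/-- **The `X`-operator rotates the `q mod 4` splitting by two**: `X ∘ P_ρ = P_{ρ + 2} ∘ X`
(multiplication by `X` shifts the quantum degree by `2` modulo `4`, `qDegree_actX_modEq`).
Rasmussen (2010), Lemma 3.5 (the involution `ι` exchanges the roles of the two summands). [cite: Rasmussen2010, Lemma 3.5] -/
theorem leeX_comp_qProj (α : G.Arc) (ρ : ZMod 4) (i : ℤ) :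
    G.leeX R α i ∘ₗ G.qProj R ρ i = G.qProj R (ρ + 2) i ∘ₗ G.leeX R α i := by
  refine LinearMap.ext (fun f ↦ funext (fun s ↦ ?_))
  simp only [LinearMap.coe_comp, Function.comp_apply, leeX_apply, qProj_apply]
  have hq : ((qDegree (G.actXDeg α i s).1 : ℤ) : ZMod 4) = (qDegree s.1 : ZMod 4) + 2 := by
    have := (ZMod.intCast_eq_intCast_iff _ _ 4).2 (qDegree_actX_modEq s.1 α)
    rw [Int.cast_add] at this
    exact_mod_cast this
  rw [hq]
  have h22 : ∀ x : ZMod 4, x + 2 + 2 = x := by decide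
  by_cases h : ((qDegree s.1 : ℤ) : ZMod 4) + 2 = ρ
  · rw [if_pos h, if_pos (by rw [← h, h22])]
  · rw [if_neg h, if_neg (fun h' ↦ h (by rw [h', h22]))]

/-- The `X`-operator maps the image of `P_ρ` into the image of `P_{ρ + 2}`. [folklore] -/
theorem qProj_leeX_qProj (α : G.Arc) (ρ : ZMod 4) (i : ℤ) (f : G.degStates i → R) :
    G.qProj R (ρ + 2) i (G.leeX R α i (G.qProj R ρ i f)) = G.leeX R α i (G.qProj R ρ i f) := by
  have h := congrArg (fun φ ↦ φ (G.qProj R ρ i f)) (G.leeX_comp_qProj R α ρ i)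
  simp only [LinearMap.coe_comp, Function.comp_apply] at h
  have hidem := congrArg (fun φ ↦ φ f) (G.qProj_comp_qProj_self R ρ i)
  simp only [LinearMap.coe_comp, Function.comp_apply] at hidem
  rw [hidem] at h
  rw [h, ← LinearMap.comp_apply (G.qProj R (ρ + 2) i), qProj_comp_qProj_self]

end Ring

end GaussDiagram

end Literature.Topology.FourManifolds
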